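import Mathlib.Combinatorics.SimpleGraph.Coloring.Vertex
import Mathlib.Data.Fin.VecNotation
import Mathlib.Data.Matrix.Basic
import Mathlib.Data.Matrix.Mul
import Mathlib.LinearAlgebra.Matrix.PosDef
import Mathlib.LinearAlgebra.Matrix.Trace
import Mathlib.Data.Rat.Star
import Mathlib.Algebra.BigOperators.Field
import Mathlib.Algebra.BigOperators.Fin
import Mathlib.Tactic.FieldSimp
import Mathlib.Tactic.LinearCombination
import Mathlib.Tactic.Positivity
import Mathlib.Data.Real.Basic
import Mathlib.Tactic.FinCases
import Mathlib.Tactic.Linarith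
import Mathlib.Tactic.NormNum
import Literature.Computability.QuantumComplexity.NonlocalGameClassicalValue
import HarnessLib

/-!
# The graphs `G₁₃`, `G₁₄` (Mančinska–Roberson): `χ(G₁₃) = 4`, `χ(G₁₄) = 5`, the classical value
# `86/88` of the `G₁₄` four-colouring game, a quantum 4-colouring of `G₁₄`, the perfect
# rank-1 quantum strategy, and the general “quantum colouring ⇒ perfect strategy” statement

Topic `Literature/Computability/QuantumComplexity`, companion of `NonlocalGameClassicalValue.lean`
(the graph-colouring game `coloringGame G c`, `|V| + 2|E|` questions, “not `c`-colourable ⇒ every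
deterministic strategy loses ≥ 2 questions”, the one-monochromatic-edge shape).  That file left
“G14's adjacency and χ(G14) = 5 (a 4¹⁴-assignment fact)” unformalised; this file supplies it.
Sources (held, read at the cited lines):

* L. Mančinska, D. E. Roberson, *Oddities of quantum colorings*, Baltic J. Modern Computing 4
  (2016) 846–859 = arXiv:1801.03542 [MancinskaRoberson2016] (held text `paper:arxiv-1801.03542`),
  §4: “To define G₁₃, we consider the nonzero three-dimensional vectors with entries from the set
  {−1,0,1}. We identify the vectors v and −v, choosing the following set of thirteen
  representatives: V := {(1,0,0),(0,1,0),(0,0,1)} ∪ {(1,1,0),(1,−1,0),(1,0,1),(1,0,−1),(0,1,1),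
  (0,1,−1)} ∪ {(1,1,1),(1,1,−1),(1,−1,1),(−1,1,1)} … we construct G₁₃ by making any two
  orthogonal vertices adjacent. That is, we let E(G₁₃) := {{u,v} : uᵀv = 0}”; “Another graph …
  is obtained by adding an apex vertex to G₁₃. We refer to this graph as G₁₄ … to vectors in V we
  add an additional coordinate which is zero and assign (0,0,0,1)ᵀ to vertex Ω”; §4.1
  “Chromatic number … G₁₃ is 4-colorable. So to establish that χ(G₁₃) = 4, it remains to argue
  that it cannot be 3-colored” (with the printed case argument); §4.3 “With G₁₄, we improve
  this to 14 vertices” (smallest known graph with χ_q < χ; χ_q(G₁₄) = 4).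
* P. J. Cameron, A. Montanaro, M. W. Newman, S. Severini, A. Winter, *On the quantum chromatic
  number of a graph*, Electron. J. Combin. 14 (2007) R81 = arXiv:quant-ph/0608016
  [CameronEtAl2007] (held text `paper:arxiv-quant-ph_0608016`), §2 (v3 only): the rank-1 model
  “Alice and Bob share a c-dimensional maximally entangled state |Φ_c⟩ … they both use rank-1
  von Neumann measurements, which are ordered bases”, Observation 1 “|f_{vα}⟩ = conj|e_{vα}⟩”,
  Observation 2 / eq. (2) “∀ vw ∈ E and ∀ α ⟨e_{vα}|e_{wα}⟩ = 0”.
* A. T. Than et al., arXiv:2603.18323v1 [ThanEtAl2026] (held text `paper:arxiv-2603.18323`),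
  p. 6: “The G14 graph coloring game is defined on a 14-vertex graph … For this graph there
  exists a perfect quantum strategy with 4 colors, while the smallest possible coloring strategy
  classically requires 5 [32, 34]. The best classical strategy using only 4 colors achieves a
  win rate of ω_c = 86/88 ≈ 0.977, failing on exactly one edge question”; p. 5 / p. 13 “51 game
  questions (14 vertices + 37 edges)”; §2.1 p. 7 “14 vertex questions … 74 directed edge questions” (eq. (4); nit LEAN-G14-R1 of REFEREE §1.197(a): these sit in §2.1 ‘Win rate measurements’, not §3).

HONEST FRAMING (pub-qadeq lane, CLAIMS row E-76 — trapped-ion win rate 0.982(3) vs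
`ω_c = 86/88`): instance-level adjudication of specific advantage claims; no claim about BQP vs
BPP or the summit.  This file makes the row's comparator a theorem: `G₁₄` (as the orthogonality
graph of the 14 printed integer vectors) has 37 edges, is 5- but not 4-colourable, and the
four-colouring game on it has classical value exactly `86` of `88` unit-weight questions.
Section `Quantum` (v2) adds the other side in Mančinska–Roberson's combinatorial form: an
explicit quantum 4-colouring of `G₁₄` in dimension 4 (Definition 1: projectors, completeness,
orthogonality — no quantum strategies or winning probabilities are defined), so
`χ_q(G₁₄) ≤ 4 < 5 = χ(G₁₄)`; section `PerfectStrategy` (v3) takes CMNSSW's rank-1-model outcome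
formula `P(α,β|v,w) = ⟨e_{vα}, e_{wβ}⟩²/c` as the definition of the strategy's statistics and
checks in exact arithmetic that it passes every one of the 88 questions with probability one
(quantum value `88/88` vs classical `86/88`).  That `G₁₃`/`G₁₄` have NO quantum 3-colouring
(MR's Theorem: `χ_q(G₁₃) = 4`) is NOT formalised, nor are the Born rule on `ℂ⁴ ⊗ ℂ⁴` behind the
quoted formula, devices, or the no-signalling premise.

## Method

Non-colourability is decided in the kernel by `decide` on a statement that quantifies the
colours vertex by vertex with the edge constraints interleaved (so the kernel's evaluation is a
backtracking search over a few hundred partial colourings, not `3¹³` / `4¹⁴` assignments); the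
graph-theoretic statements are then one-line consequences (`Coloring.valid`).

## Contents (all proved, 0 named facts)

* `vec13`, `vec14`, `dot3`, `dot4`, **`G13`**, **`G14`** (orthogonality graphs, decidable
  adjacency), `card_edgeFinset_G13 = 24`, **`card_edgeFinset_G14 = 37`**,
  `card_coloringQuestions_G14 = 88`.
* `not_colorable_three_G13`, `colorable_four_G13`, **`chromaticNumber_G13 : χ(G₁₃) = 4`**;
  `not_colorable_four_G14`, `colorable_five_G14`, **`chromaticNumber_G14 : χ(G₁₄) = 5`**.
* The game: `oneMono` (a 4-colour assignment with exactly one monochromatic edge),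
  `card_losses_oneMono = 2`, `detValue_oneMono = 86`, `detValue_G14_le` (every deterministic
  strategy wins ≤ 86 questions), **`classicalValue_coloringGame_G14 = 86`** and
  **`classicalValue_ratio_G14 : … / #questions = 86/88`**.
* Section `Quantum` (v2): `QuantumColouring H c d K` (MR Definition 1, real form),
  `QuantumColouring.ofColoring` (classical ⇒ dimension-1 quantum), `quatCol` (the quaternion
  columns `r⁰,…,r³`), `colVec_orthogonal` / `colVec_complete` / `colVec_adj` (integer
  certificates, decided), `projQ`, **`quantumFourColouring_G14 : QuantumColouring G14 4 4 ℚ`**,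
  **`quantum_classical_gap_G14`** [cite: MancinskaRoberson2016, Definition 1, §3 Lemma 1, §4.3].
* Section `PerfectStrategy` (v3): `bornQ` (rank-1 model statistics `⟨e_{vα},e_{wβ}⟩²/4`),
  `bornQ_nonneg`, `sum_bornQ` (a probability distribution for every question pair),
  `bornQ_same_vertex`, `bornQ_adj`, `passProb`, **`passProb_eq_one`** (every one of the 88
  questions is passed with probability one), `sum_passProb = 88`
  [cite: CameronEtAl2007, §2 (rank-1 model, Observations 1–2); ThanEtAl2026, p. 6].
* Section `General` (v4): for EVERY quantum `c`-colouring (real form, ordered field):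
  **`QuantumColouring.proj_mul_proj_of_ne`** (projectors of one vertex are mutually orthogonal —
  forced by completeness), `traceProb` (`Tr(P_{vα}P_{wβ})/d`, CMNSSW Proposition 1's model, taken
  as definition), `sum_traceProb`, `traceProb_same_vertex`, `traceProb_adj`,
  **`tracePass_eq_one`** (every question passed with probability one), and for `G₁₄`
  `bornQ_eq_traceProb` [cite: CameronEtAl2007, §2 eq. (1), Proposition 1].
-/

namespace Literature.Computability.QuantumComplexity

namespace G14Game

open Finset

/-! ## The graphs -/

/-- The thirteen representatives `V` of the nonzero `{−1,0,1}`-vectors of `ℝ³` up to sign, in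
the printed order (face midpoints, edge midpoints, vertices of the cube).
[cite: MancinskaRoberson2016, §4 eq. (V)] -/
def vec13 : Fin 13 → ℤ × ℤ × ℤ :=
  ![(1, 0, 0), (0, 1, 0), (0, 0, 1), (1, 1, 0), (1, -1, 0), (1, 0, 1), (1, 0, -1), (0, 1, 1),
    (0, 1, -1), (1, 1, 1), (1, 1, -1), (1, -1, 1), (-1, 1, 1)]

/-- The integer dot product on `ℤ³` (plumbing). [folklore] -/
def dot3 (u v : ℤ × ℤ × ℤ) : ℤ := u.1 * v.1 + u.2.1 * v.2.1 + u.2.2 * v.2.2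

/-- **`G₁₃`**: “we construct G₁₃ by making any two orthogonal vertices adjacent”,
`E(G₁₃) = {{u,v} : uᵀv = 0}`. [cite: MancinskaRoberson2016, §4] -/
def G13 : SimpleGraph (Fin 13) where
  Adj i j := i ≠ j ∧ dot3 (vec13 i) (vec13 j) = 0
  symm := ⟨fun _ _ h => ⟨h.1.symm, by rw [← h.2]; unfold dot3; ring⟩⟩
  loopless := ⟨fun _ h => h.1 rfl⟩

/-- Adjacency in `G₁₃` is decidable (plumbing). [folklore] -/
instance : DecidableRel G13.Adj := fun i j =>
  inferInstanceAs (Decidable (i ≠ j ∧ dot3 (vec13 i) (vec13 j) = 0))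

/-- The four-dimensional orthogonal representation of `G₁₄`: the vectors of `V` with a zero
fourth coordinate, and `(0,0,0,1)` for the apex `Ω` (our vertex `13`).
[cite: MancinskaRoberson2016, §4 (“to vectors in V we add an additional coordinate which is zero and assign (0,0,0,1)ᵀ to vertex Ω”)] -/
def vec14 : Fin 14 → ℤ × ℤ × ℤ × ℤ :=
  ![(1, 0, 0, 0), (0, 1, 0, 0), (0, 0, 1, 0), (1, 1, 0, 0), (1, -1, 0, 0), (1, 0, 1, 0),
    (1, 0, -1, 0), (0, 1, 1, 0), (0, 1, -1, 0), (1, 1, 1, 0), (1, 1, -1, 0), (1, -1, 1, 0),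
    (-1, 1, 1, 0), (0, 0, 0, 1)]

/-- The integer dot product on `ℤ⁴` (plumbing). [folklore] -/
def dot4 (u v : ℤ × ℤ × ℤ × ℤ) : ℤ :=
  u.1 * v.1 + u.2.1 * v.2.1 + u.2.2.1 * v.2.2.1 + u.2.2.2 * v.2.2.2

/-- **`G₁₄` = `G₁₃` plus an apex vertex `Ω`**, realised as the orthogonality graph of `vec14`
(the apex vector `(0,0,0,1)` is orthogonal to all of `V × {0}`, and orthogonality inside
`V × {0}` is that of `V`). [cite: MancinskaRoberson2016, §4 (“adding an apex vertex to G₁₃. We refer to this graph as G₁₄”); ThanEtAl2026, p. 6 (“a 14-vertex graph”)] -/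
def G14 : SimpleGraph (Fin 14) where
  Adj i j := i ≠ j ∧ dot4 (vec14 i) (vec14 j) = 0
  symm := ⟨fun _ _ h => ⟨h.1.symm, by rw [← h.2]; unfold dot4; ring⟩⟩
  loopless := ⟨fun _ h => h.1 rfl⟩

/-- Adjacency in `G₁₄` is decidable (plumbing). [folklore] -/
instance : DecidableRel G14.Adj := fun i j =>
  inferInstanceAs (Decidable (i ≠ j ∧ dot4 (vec14 i) (vec14 j) = 0))

/-- Vertex `13` is an apex of `G₁₄`: adjacent to every other vertex.
[cite: MancinskaRoberson2016, §4 (apex vertex Ω)] -/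
theorem G14_adj_apex (i : Fin 14) (hi : i ≠ 13) : G14.Adj 13 i := by
  revert i; decide

/-- On the first thirteen vertices `G₁₄` is `G₁₃`. [cite: MancinskaRoberson2016, §4] -/
theorem G14_adj_castSucc (i j : Fin 13) : G14.Adj i.castSucc j.castSucc ↔ G13.Adj i j := by
  revert i j; decide

/-- `G₁₃` has 24 edges (the ten “middle” vertices form a Petersen graph: 15, plus the triangle of
face midpoints: 3, plus 6 joining them). [cite: MancinskaRoberson2016, §4 (Figure: “the ten middle vertices form a Petersen graph”)] -/
theorem card_edgeFinset_G13 : G13.edgeFinset.card = 24 := by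
  have h := card_coloringQuestions G13
  have hq : (coloringQuestions G13).card = 61 := by decide
  simp only [Fintype.card_fin] at h
  omega

/-- **`G₁₄` has 37 edges** (“51 game questions (14 vertices + 37 edges)”).
[cite: ThanEtAl2026, p. 5 (Fig. 1 caption) and Methods p. 13] -/
theorem card_edgeFinset_G14 : G14.edgeFinset.card = 37 := by
  have h := card_coloringQuestions G14
  have hq : (coloringQuestions G14).card = 88 := by decide
  simp only [Fintype.card_fin] at h
  omega

/-- **88 questions**: “14 vertex questions (v, v) … 74 directed edge questions”.
[cite: ThanEtAl2026, §2.1 “Win rate measurements” (p. 7)] -/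
theorem card_coloringQuestions_G14 : (coloringQuestions G14).card = 88 := by decide

/-! ## Chromatic numbers -/

set_option synthInstance.maxSize 100000 in
set_option synthInstance.maxHeartbeats 400000 in
/-- Kernel search: no proper 3-colouring of `G₁₃` (colours chosen vertex by vertex, each edge
constraint imposed as soon as both endpoints are coloured; plumbing). [folklore] -/
private theorem noThree_G13 :
    ∀ c0 : Fin 3, 
      ∀ c1 : Fin 3, c0 ≠ c1 → 
      ∀ c2 : Fin 3, c0 ≠ c2 → c1 ≠ c2 → 
      ∀ c3 : Fin 3, c2 ≠ c3 → 
      ∀ c4 : Fin 3, c2 ≠ c4 → c3 ≠ c4 → 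
      ∀ c5 : Fin 3, c1 ≠ c5 → 
      ∀ c6 : Fin 3, c1 ≠ c6 → c5 ≠ c6 → 
      ∀ c7 : Fin 3, c0 ≠ c7 → 
      ∀ c8 : Fin 3, c0 ≠ c8 → c7 ≠ c8 → 
      ∀ c9 : Fin 3, c4 ≠ c9 → c6 ≠ c9 → c8 ≠ c9 → 
      ∀ c10 : Fin 3, c4 ≠ c10 → c5 ≠ c10 → c7 ≠ c10 → 
      ∀ c11 : Fin 3, c3 ≠ c11 → c6 ≠ c11 → c7 ≠ c11 → 
      ∀ c12 : Fin 3, c3 ≠ c12 → c5 ≠ c12 → c8 ≠ c12 → False := by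
  decide

/-- **`G₁₃` is not 3-colourable.** [cite: MancinskaRoberson2016, §4.1 (“it remains to argue that it cannot be 3-colored … we have reached a contradiction”)] -/
theorem not_colorable_three_G13 : ¬ G13.Colorable 3 := by
  rintro ⟨C⟩
  exact noThree_G13 (C 0) (C 1) (C.valid (show G13.Adj 0 1 by decide)) (C 2) (C.valid (show G13.Adj 0 2 by decide)) (C.valid (show G13.Adj 1 2 by decide)) (C 3) (C.valid (show G13.Adj 2 3 by decide)) (C 4) (C.valid (show G13.Adj 2 4 by decide)) (C.valid (show G13.Adj 3 4 by decide)) (C 5) (C.valid (show G13.Adj 1 5 by decide)) (C 6) (C.valid (show G13.Adj 1 6 by decide)) (C.valid (show G13.Adj 5 6 by decide)) (C 7) (C.valid (show G13.Adj 0 7 by decide)) (C 8) (C.valid (show G13.Adj 0 8 by decide)) (C.valid (show G13.Adj 7 8 by decide)) (C 9) (C.valid (show G13.Adj 4 9 by decide)) (C.valid (show G13.Adj 6 9 by decide)) (C.valid (show G13.Adj 8 9 by decide)) (C 10) (C.valid (show G13.Adj 4 10 by decide)) (C.valid (show G13.Adj 5 10 by decide)) (C.valid (show G13.Adj 7 10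 by decide)) (C 11) (C.valid (show G13.Adj 3 11 by decide)) (C.valid (show G13.Adj 6 11 by decide)) (C.valid (show G13.Adj 7 11 by decide)) (C 12) (C.valid (show G13.Adj 3 12 by decide)) (C.valid (show G13.Adj 5 12 by decide)) (C.valid (show G13.Adj 8 12 by decide))

/-- A proper 4-colouring of `G₁₃` (colour classes `{0,3,5,9}`, `{1,4,7,12}`, `{2,6,8,10}`,
`{11}` in our numbering; the source partitions into the independent sets {A,W,X,Y,Z}, {B,L,R},
{C,M,N}, {P,Q} of its lettering). [cite: MancinskaRoberson2016, §4.1 (“Therefore, G₁₃ is 4-colorable”)] -/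
def fourColouring13 : Fin 13 → Fin 4 := ![0, 1, 2, 0, 1, 0, 2, 1, 2, 0, 2, 3, 1]

/-- **`G₁₃` is 4-colourable.** [cite: MancinskaRoberson2016, §4.1] -/
theorem colorable_four_G13 : G13.Colorable 4 :=
  ⟨SimpleGraph.Coloring.mk fourColouring13 (by decide)⟩

/-- **`χ(G₁₃) = 4`.** [cite: MancinskaRoberson2016, §4.1 (table of parameters and “χ(G₁₃) = 4”)] -/
theorem chromaticNumber_G13 : G13.chromaticNumber = 4 :=
  SimpleGraph.chromaticNumber_eq_iff_colorable_not_colorable.2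
    ⟨colorable_four_G13, not_colorable_three_G13⟩

set_option synthInstance.maxSize 100000 in
set_option synthInstance.maxHeartbeats 400000 in
/-- Kernel search: no proper 4-colouring of `G₁₄` (apex first; plumbing). [folklore] -/
private theorem noFour_G14 :
    ∀ c13 : Fin 4, 
      ∀ c0 : Fin 4, c13 ≠ c0 → 
      ∀ c1 : Fin 4, c13 ≠ c1 → c0 ≠ c1 → 
      ∀ c2 : Fin 4, c13 ≠ c2 → c0 ≠ c2 → c1 ≠ c2 → 
      ∀ c3 : Fin 4, c13 ≠ c3 → c2 ≠ c3 → 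
      ∀ c4 : Fin 4, c13 ≠ c4 → c2 ≠ c4 → c3 ≠ c4 → 
      ∀ c5 : Fin 4, c13 ≠ c5 → c1 ≠ c5 → 
      ∀ c6 : Fin 4, c13 ≠ c6 → c1 ≠ c6 → c5 ≠ c6 → 
      ∀ c7 : Fin 4, c13 ≠ c7 → c0 ≠ c7 → 
      ∀ c8 : Fin 4, c13 ≠ c8 → c0 ≠ c8 → c7 ≠ c8 → 
      ∀ c9 : Fin 4, c13 ≠ c9 → c4 ≠ c9 → c6 ≠ c9 → c8 ≠ c9 → 
      ∀ c10 : Fin 4, c13 ≠ c10 → c4 ≠ c10 → c5 ≠ c10 → c7 ≠ c10 → 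
      ∀ c11 : Fin 4, c13 ≠ c11 → c3 ≠ c11 → c6 ≠ c11 → c7 ≠ c11 → 
      ∀ c12 : Fin 4, c13 ≠ c12 → c3 ≠ c12 → c5 ≠ c12 → c8 ≠ c12 → False := by
  decide

/-- **`G₁₄` is not 4-colourable** — “the smallest possible coloring strategy classically requires
5”. [cite: ThanEtAl2026, p. 6; MancinskaRoberson2016, §4 (G₁₄ = apex over G₁₃ with χ(G₁₃) = 4)] -/
theorem not_colorable_four_G14 : ¬ G14.Colorable 4 := by
  rintro ⟨C⟩
  exact noFour_G14 (C 13) (C 0) (C.valid (show G14.Adj 13 0 by decide)) (C 1) (C.valid (show G14.Adj 13 1 by decide)) (C.valid (show G14.Adj 0 1 by decide)) (C 2) (C.valid (show G14.Adj 13 2 by decide)) (C.valid (show G14.Adj 0 2 by decide)) (C.valid (show G14.Adj 1 2 by decide)) (C 3) (C.valid (show G14.Adj 13 3 by decide)) (C.valid (show G14.Adj 2 3 by decide)) (C 4) (C.valid (show G14.Adj 13 4 by decide)) (C.valid (show G14.Adj 2 4 by decide)) (C.valid (show G14.Adj 3 4 by decide)) (C 5) (C.valid (show G14.Adj 13 5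 by decide)) (C.valid (show G14.Adj 1 5 by decide)) (C 6) (C.valid (show G14.Adj 13 6 by decide)) (C.valid (show G14.Adj 1 6 by decide)) (C.valid (show G14.Adj 5 6 by decide)) (C 7) (C.valid (show G14.Adj 13 7 by decide)) (C.valid (show G14.Adj 0 7 by decide)) (C 8) (C.valid (show G14.Adj 13 8 by decide)) (C.valid (show G14.Adj 0 8 by decide)) (C.valid (show G14.Adj 7 8 by decide)) (C 9) (C.valid (show G14.Adj 13 9 by decide)) (C.valid (show G14.Adj 4 9 by decide)) (C.valid (show G14.Adj 6 9 by decide)) (C.valid (show G14.Adj 8 9 by decide)) (C 10) (C.valid (show G14.Adj 13 10 by decide)) (C.valid (show G14.Adj 4 10 by decide)) (C.valid (show G14.Adj 5 10 by decide)) (C.valid (show G14.Adj 7 10 by decide)) (C 11) (C.valid (show G14.Adj 13 11 by decide)) (C.valid (show G14.Adj 3 11 by decide)) (C.valid (show G14.Adj 6 11 by decide)) (C.valid (show G14.Adj 7 11 by decide)) (C 12) (C.valid (show G14.Adj 13 12 by decide)) (C.valid (show G14.Adj 3 12 by decide)) (C.valid (show G14.Adj 5 12 by decide)) (C.valid (show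 G14.Adj 8 12 by decide))

/-- A proper 5-colouring of `G₁₄`: the 4-colouring of `G₁₃` and a fifth colour for the apex.
[cite: MancinskaRoberson2016, §4.1 with §4 (apex)] -/
def fiveColouring14 : Fin 14 → Fin 5 := ![0, 1, 2, 0, 1, 0, 2, 1, 2, 0, 2, 3, 1, 4]

/-- **`G₁₄` is 5-colourable.** [cite: ThanEtAl2026, p. 6 (“classically requires 5”)] -/
theorem colorable_five_G14 : G14.Colorable 5 :=
  ⟨SimpleGraph.Coloring.mk fiveColouring14 (by decide)⟩

/-- **`χ(G₁₄) = 5`.** [cite: ThanEtAl2026, p. 6; MancinskaRoberson2016, §4.3 (“With G₁₄, we improve this to 14 vertices”: χ(G₁₄) > χ_q(G₁₄) = 4)] -/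
theorem chromaticNumber_G14 : G14.chromaticNumber = 5 :=
  SimpleGraph.chromaticNumber_eq_iff_colorable_not_colorable.2
    ⟨colorable_five_G14, not_colorable_four_G14⟩

/-! ## The four-colouring game on `G₁₄`: `ω_c = 86/88` -/

/-- A 4-colour assignment with exactly ONE monochromatic edge (vertices `0`, `1` — the face
midpoints `(1,0,0)`, `(0,1,0)` — share colour `0`; the apex alone has colour `3`): the shape of
“the optimal classical strategy … failing on the single edge whose endpoints share a color”.
[cite: ThanEtAl2026, §2.1 “Win rate measurements” (p. 7)] -/
def oneMono : Fin 14 → Fin 4 := ![0, 0, 1, 0, 2, 1, 2, 2, 1, 0, 0, 1, 2, 3]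

/-- Both players answering with `oneMono` lose exactly the two orientations of the edge `{0,1}`.
[cite: ThanEtAl2026, §2.1 (p. 7: “winning only 72 of the 74 directed edge questions, failing on the single edge whose endpoints share a color”)] -/
theorem card_losses_oneMono : (losses G14 4 oneMono oneMono).card = 2 := by decide

/-- … hence win `86` of the `88` questions. [cite: ThanEtAl2026, §1.2 (p. 6: “ω_c = 86/88”) and §2.1 (p. 7)] -/
theorem detValue_oneMono : (coloringGame G14 4).detValue oneMono oneMono = 86 := by
  rw [detValue_coloringGame]
  have h := card_wins_add_card_losses G14 4 oneMono oneMono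
  rw [card_losses_oneMono, card_coloringQuestions_G14] at h
  have hw : (wins G14 4 oneMono oneMono).card = 86 := by omega
  rw [hw]; norm_num

/-- **Every deterministic 4-colour strategy wins at most `86` of the `88` questions** (since
`G₁₄` is not 4-colourable, at least two directed questions are lost).
[cite: ThanEtAl2026, p. 6 (“The best classical strategy using only 4 colors achieves a win rate of ω_c = 86/88”)] -/
theorem detValue_G14_le (f g : Fin 14 → Fin 4) : (coloringGame G14 4).detValue f g ≤ 86 := by
  have h := detValue_coloringGame_le G14 4 not_colorable_four_G14 f g
  rw [card_edgeFinset_G14, Fintype.card_fin] at h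
  norm_num at h
  linarith

/-- **The classical value of the `G₁₄` four-colouring game is `86`** (unit weight per question).
[cite: ThanEtAl2026, §1.2 (p. 6) and §2.1 (p. 7)] -/
theorem classicalValue_coloringGame_G14 : (coloringGame G14 4).classicalValue = 86 :=
  le_antisymm (NonlocalGame.classicalValue_le detValue_G14_le)
    (detValue_oneMono ▸ (coloringGame G14 4).detValue_le_classicalValue _ _)

/-- **`ω_c(G₁₄) = 86/88`** under the uniform question distribution of eq. (4) (normalising the
unit weights by the `88` questions). [cite: ThanEtAl2026, §1.2 (p. 6: “ω_c = 86/88 ≈ 0.977”) and §2.1 eq. (4) (p. 7)] -/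
theorem classicalValue_ratio_G14 :
    (coloringGame G14 4).classicalValue / (coloringQuestions G14).card = 86 / 88 := by
  rw [classicalValue_coloringGame_G14, card_coloringQuestions_G14]; norm_num


/-! ## A quantum 4-colouring of `G₁₄` (v2): the separation `χ_q(G₁₄) ≤ 4 < 5 = χ(G₁₄)`

Mančinska–Roberson's Definition 1 reformulates quantum strategies for the colouring game
combinatorially: a quantum `c`-colouring in dimension `d` is a family of orthogonal projectors
`(v_i : v ∈ V(G), i ∈ [c])` with `Σ_i v_i = I_d` (completeness) and `v_i w_i = 0` for `v ∼ w`
(orthogonality); “any classical c-coloring can be viewed as a 1-dimensional quantum coloring”.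
Their §3 construction (Lemma 1, from [Cameron07]) turns a REAL orthogonal representation in
dimension four into a quantum 4-colouring: the four vectors `r⁰, r¹, r², r³` obtained from
`r = φ(v)` as the columns of the matrix `((r₀,−r₁,−r₂,−r₃),(r₁,r₀,r₃,−r₂),(r₂,−r₃,r₀,r₁),
(r₃,r₂,−r₁,r₀))` form an orthogonal basis, and `v_i` := the projection onto `rⁱ`; for `u ∼ v`
the vectors `φ(u)ⁱ`, `φ(v)ⁱ` are orthogonal “since these were obtained by permuting and changing
some of the signs of the coordinates”.  Than et al. use the same quaternion matrices `M_q`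
(Supplementary Note 4.3, eq. (S12)) for the hardware strategy.  Below: the definition (REAL
form — symmetric idempotents over a field; a real quantum colouring is in particular a complex
one), the dimension-one embedding of classical colourings, and the explicit quantum 4-colouring
of `G₁₄` in dimension 4 with RATIONAL projectors `rⁱ(rⁱ)ᵀ/‖r‖²`, certified by integer identities
decided in the kernel.  Nothing here defines quantum strategies or winning probabilities of the
game (MR: “without defining quantum strategies in their full generality”). -/

section Quantum

/-- **Quantum `c`-colouring in dimension `d`** (Mančinska–Roberson Definition 1, REAL form over a
field `K`: “orthogonal projector” = symmetric idempotent matrix): projectors `proj v i` with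
`Σ_{i∈[c]} proj v i = I_d` for every vertex (completeness) and `proj v i * proj w i = 0` for
all `v ∼ w` and all `i` (orthogonality). [cite: MancinskaRoberson2016, §2 Definition 1] -/
structure QuantumColouring {W : Type*} (H : SimpleGraph W) (c d : ℕ) (K : Type*) [Field K] where
  /-- the projector of vertex `v` and colour `i` -/
  proj : W → Fin c → Matrix (Fin d) (Fin d) K
  /-- symmetric … -/
  symm : ∀ v i, (proj v i).transpose = proj v i
  /-- … idempotent (“orthogonal projectors”) -/
  idem : ∀ v i, proj v i * proj v i = proj v i
  /-- completeness `Σ_i v_i = I_d` -/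
  complete : ∀ v, ∑ i, proj v i = 1
  /-- orthogonality `v_i w_i = 0` along every edge -/
  orth : ∀ v w, H.Adj v w → ∀ i, proj v i * proj w i = 0

/-- “Any classical c-coloring can be viewed as a 1-dimensional quantum coloring, where we set
v_i = 1 if vertex v has been assigned color i and we set v_i = 0 otherwise.”
[cite: MancinskaRoberson2016, §2 (remark after Definition 1: “Therefore … χ(G) ≥ χ_q(G)”)] -/
def QuantumColouring.ofColoring {W : Type*} {H : SimpleGraph W} {c : ℕ} (K : Type*) [Field K]
    (C : H.Coloring (Fin c)) : QuantumColouring H c 1 K where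
  proj v i := if C v = i then 1 else 0
  symm v i := by split_ifs <;> simp
  idem v i := by split_ifs <;> simp
  complete v := by rw [Finset.sum_ite_eq, if_pos (Finset.mem_univ _)]
  orth v w h i := by
    by_cases hv : C v = i
    · have hw : C w ≠ i := fun hw => C.valid h (hv.trans hw.symm)
      simp [hv, hw]
    · simp [hv]

/-- The vectors of the orthogonal representation as functions `Fin 4 → ℤ` (plumbing). [folklore] -/
def vecZ (v : Fin 14) : Fin 4 → ℤ :=
  ![(vec14 v).1, (vec14 v).2.1, (vec14 v).2.2.1, (vec14 v).2.2.2]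

/-- The four columns `r⁰, r¹, r², r³` of the quaternion matrix of `r = (r₀,r₁,r₂,r₃)`:
`r⁰ = r`, `r¹ = (−r₁, r₀, −r₃, r₂)`, `r² = (−r₂, r₃, r₀, −r₁)`, `r³ = (−r₃, −r₂, r₁, r₀)`.
[cite: MancinskaRoberson2016, §3 (the displayed 4 × 4 matrix before Lemma 1); ThanEtAl2026, Supplementary Note 4.3 eq. (S12) (the quaternion matrix M_q)] -/
def quatCol (r : Fin 4 → ℤ) : Fin 4 → Fin 4 → ℤ :=
  ![![r 0, r 1, r 2, r 3], ![-r 1, r 0, -r 3, r 2], ![-r 2, r 3, r 0, -r 1], ![-r 3, -r 2, r 1, r 0]]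

/-- The explicit dot product on `ℤ⁴` (plumbing). [folklore] -/
def dotZ (x y : Fin 4 → ℤ) : ℤ := x 0 * y 0 + x 1 * y 1 + x 2 * y 2 + x 3 * y 3

/-- Colour-`i` vector of vertex `v`: `φ(v)ⁱ` (plumbing). [folklore] -/
def colVec (v : Fin 14) (i : Fin 4) : Fin 4 → ℤ := quatCol (vecZ v) i

/-- `‖φ(v)‖²` (`= 1, 2` or `3`; plumbing). [folklore] -/
def normSq (v : Fin 14) : ℤ := dotZ (vecZ v) (vecZ v)

/-- The four vectors `φ(v)ⁱ` are pairwise orthogonal of squared norm `‖φ(v)‖²` (“form an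
orthonormal basis” after normalisation) — decided for the 14 vertices.
[cite: MancinskaRoberson2016, §3 (“all four vectors are pairwise orthogonal and thus form an orthonormal basis”)] -/
theorem colVec_orthogonal : ∀ v : Fin 14, ∀ i j : Fin 4,
    dotZ (colVec v i) (colVec v j) = if i = j then normSq v else 0 := by
  decide

/-- Completeness at the integer level: `Σ_i φ(v)ⁱ_a φ(v)ⁱ_b = ‖φ(v)‖² δ_{ab}` (the four
normalised vectors resolve the identity) — decided. [cite: MancinskaRoberson2016, §3 (“The completeness condition … is satisfied since the vectors φ(v)ⁱ form an orthonormal basis”)] -/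
theorem colVec_complete : ∀ v : Fin 14, ∀ a b : Fin 4,
    colVec v 0 a * colVec v 0 b + colVec v 1 a * colVec v 1 b + colVec v 2 a * colVec v 2 b +
      colVec v 3 a * colVec v 3 b = if a = b then normSq v else 0 := by
  decide

/-- Orthogonality along edges: for `u ∼ v` in `G₁₄` and every colour `i`, `φ(u)ⁱ ⊥ φ(v)ⁱ` —
decided for the 37 edges. [cite: MancinskaRoberson2016, §3 (“φ(u)ⁱ and φ(v)ⁱ being orthogonal, which holds since these were obtained by permuting and changing some of the signs of the coordinates”)] -/
theorem colVec_adj : ∀ v w : Fin 14, G14.Adj v w → ∀ i : Fin 4,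
    dotZ (colVec v i) (colVec w i) = 0 := by
  decide

/-- The squared norms are positive (plumbing). [folklore] -/
private theorem normSq_pos : ∀ v : Fin 14, 0 < normSq v := by decide

/-- The rational projector onto `φ(v)ⁱ`: `(φ(v)ⁱ (φ(v)ⁱ)ᵀ) / ‖φ(v)‖²`.
[cite: MancinskaRoberson2016, §3 (“we let v_i be the projection onto vector φ(v)ⁱ”)] -/
def projQ (v : Fin 14) (i : Fin 4) : Matrix (Fin 4) (Fin 4) ℚ :=
  Matrix.of fun a b => (colVec v i a : ℚ) * (colVec v i b : ℚ) / (normSq v : ℚ)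

/-- `Σ_k (φ(v)ⁱ_k)² = ‖φ(v)‖²` over `ℚ` (plumbing). [folklore] -/
private theorem sum_sq_colVec (v : Fin 14) (i : Fin 4) :
    ((colVec v i 0 : ℚ) * colVec v i 0 + (colVec v i 1 : ℚ) * colVec v i 1 +
      (colVec v i 2 : ℚ) * colVec v i 2 + (colVec v i 3 : ℚ) * colVec v i 3) = normSq v := by
  have h := colVec_orthogonal v i i
  rw [if_pos rfl] at h
  unfold dotZ at h
  exact_mod_cast h

/-- `Σ_k φ(v)ⁱ_k φ(w)ⁱ_k = 0` over `ℚ` along an edge (plumbing). [folklore] -/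
private theorem sum_colVec_adj {v w : Fin 14} (h : G14.Adj v w) (i : Fin 4) :
    ((colVec v i 0 : ℚ) * colVec w i 0 + (colVec v i 1 : ℚ) * colVec w i 1 +
      (colVec v i 2 : ℚ) * colVec w i 2 + (colVec v i 3 : ℚ) * colVec w i 3) = 0 := by
  have h' := colVec_adj v w h i
  unfold dotZ at h'
  exact_mod_cast h'

/-- **A quantum 4-colouring of `G₁₄` in dimension 4** — Lemma 1's construction applied to the
four-dimensional orthogonal representation `vec14` (the same quaternion matrices as the trapped-ion
strategy of [ThanEtAl2026]).  [cite: MancinskaRoberson2016, §3 Lemma 1 (“If a graph G has a real orthogonal representation in dimension four, then χ_q(G) ≤ 4”) with §4 / §4.3 (“G₁₄ has a four-dimensional orthogonal representation, and so … χ_q(G₁₄) ≤ 4”); ThanEtAl2026, Supplementary Note 4.3] -/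
def quantumFourColouring_G14 : QuantumColouring G14 4 4 ℚ where
  proj := projQ
  symm v i := by
    ext a b
    simp only [projQ, Matrix.transpose_apply, Matrix.of_apply]
    ring
  idem v i := by
    ext a b
    have hn : (normSq v : ℚ) ≠ 0 := by exact_mod_cast (normSq_pos v).ne'
    have hs := sum_sq_colVec v i
    rw [Matrix.mul_apply, Fin.sum_univ_four]
    simp only [projQ, Matrix.of_apply]
    field_simp
    linear_combination ((colVec v i a : ℚ) * (colVec v i b : ℚ)) * hs
  complete v := by
    ext a b
    have hn : (normSq v : ℚ) ≠ 0 := by exact_mod_cast (normSq_pos v).ne'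
    have hc := colVec_complete v a b
    rw [Matrix.sum_apply, Fin.sum_univ_four]
    simp only [projQ, Matrix.of_apply, Matrix.one_apply]
    by_cases hab : a = b
    · rw [if_pos hab] at hc ⊢
      have hc' : ((colVec v 0 a : ℚ) * colVec v 0 b + (colVec v 1 a : ℚ) * colVec v 1 b +
          (colVec v 2 a : ℚ) * colVec v 2 b + (colVec v 3 a : ℚ) * colVec v 3 b) = normSq v := by
        exact_mod_cast hc
      field_simp
      linear_combination hc'
    · rw [if_neg hab] at hc ⊢
      have hc' : ((colVec v 0 a : ℚ) * colVec v 0 b + (colVec v 1 a : ℚ) * colVec v 1 b +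
          (colVec v 2 a : ℚ) * colVec v 2 b + (colVec v 3 a : ℚ) * colVec v 3 b) = 0 := by
        exact_mod_cast hc
      field_simp
      linear_combination hc'
  orth v w h i := by
    ext a b
    have hn : (normSq v : ℚ) ≠ 0 := by exact_mod_cast (normSq_pos v).ne'
    have hm : (normSq w : ℚ) ≠ 0 := by exact_mod_cast (normSq_pos w).ne'
    have hs := sum_colVec_adj h i
    rw [Matrix.mul_apply, Fin.sum_univ_four]
    simp only [projQ, Matrix.of_apply, Matrix.zero_apply]
    field_simp
    linear_combination ((colVec v i a : ℚ) * (colVec w i b : ℚ)) * hs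

/-- **`G₁₄` separates quantum from classical colouring**: it has a quantum 4-colouring (in
dimension 4, over `ℚ ⊂ ℝ`) but no classical 4-colouring — “there exists a perfect quantum
strategy with 4 colors, while the smallest possible coloring strategy classically requires 5”;
`χ_q(G₁₄) ≤ 4 < 5 = χ(G₁₄)`. [cite: MancinskaRoberson2016, §4.3 (“With G₁₄, we improve this to 14 vertices”; Fact 2); ThanEtAl2026, p. 6] -/
theorem quantum_classical_gap_G14 :
    Nonempty (QuantumColouring G14 4 4 ℚ) ∧ ¬ G14.Colorable 4 ∧ G14.chromaticNumber = 5 :=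
  ⟨⟨quantumFourColouring_G14⟩, not_colorable_four_G14, chromaticNumber_G14⟩

end Quantum


/-! ## The perfect quantum strategy (v3): CMNSSW's rank-1 model wins every question

Cameron–Montanaro–Newman–Severini–Winter describe the “rank-1 model” of a quantum strategy for
the colouring game: “Alice and Bob share a c-dimensional maximally entangled state
|Φ_c⟩ = c^{−1/2} Σ_{i} |i⟩_A|i⟩_B.  To make their choices, they both use rank-1 von Neumann
measurements, which are ordered bases (|e_{vα}⟩)_α and (|f_{vβ}⟩)_β”; consistency forces
`|f_{vα}⟩ = conj |e_{vα}⟩` (Observation 1), “⟨f_{wα}|Φ_c⟩ = c^{−1/2} conj|f_{wα}⟩”, and the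
colouring condition becomes “∀ vw ∈ E and ∀ α ⟨e_{vα}|e_{wα}⟩ = 0” (Observation 2, eq. (2)).
For REAL bases this gives the outcome statistics `P(α, β | v, w) = |⟨e_{vα}|⟨f_{wβ}|Φ_c⟩|² =
⟨e_{vα}, e_{wβ}⟩² / c`.  Below this formula — with `c = 4` and the orthonormal bases
`e_{vα} = φ(v)^α/‖φ(v)‖` of the previous section — is TAKEN AS THE DEFINITION of the
strategy's statistics (`bornQ`; the Hilbert-space derivation of the display from the Born rule
on `ℂ⁴ ⊗ ℂ⁴` is the two quoted lines of the source and is not re-derived here), and the kernel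
checks, in exact rational arithmetic, that it is a probability distribution on answer pairs for
every question pair and that it satisfies the colouring rule with probability ONE on each of the
88 questions of the `G₁₄` game: the quantum value is `1 = 88/88` against the classical `86/88`. -/

section PerfectStrategy

/-- **Outcome statistics of the rank-1 quantum strategy** built from the quaternion bases: on
questions `(v, w)` Alice and Bob answer `(α, β)` with probability
`⟨e_{vα}, e_{wβ}⟩² / 4 = ⟨φ(v)^α, φ(w)^β⟩² / (4 ‖φ(v)‖² ‖φ(w)‖²)` — CMNSSW's rank-1 model with
the maximally entangled state `|Φ₄⟩` and real bases (`f = conj e = e`), taken as the definition.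
[cite: CameronEtAl2007, §2 (rank-1 model: “|Φ_c⟩ = c^{−1/2} Σ|i⟩_A|i⟩_B … rank-1 von Neumann measurements, which are ordered bases”, Observation 1 “|f_{vα}⟩ = conj|e_{vα}⟩”, “⟨f_{wα}|Φ_c⟩ = c^{−1/2} conj|f_{wα}⟩”)] -/
def bornQ (v w : Fin 14) (α β : Fin 4) : ℚ :=
  (dotZ (colVec v α) (colVec w β) : ℚ) ^ 2 / (4 * (normSq v : ℚ) * (normSq w : ℚ))

/-- The statistics are nonnegative. [cite: CameronEtAl2007, §2] -/
theorem bornQ_nonneg (v w : Fin 14) (α β : Fin 4) : 0 ≤ bornQ v w α β := by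
  unfold bornQ
  have hv : (0 : ℚ) < normSq v := by exact_mod_cast normSq_pos v
  have hw : (0 : ℚ) < normSq w := by exact_mod_cast normSq_pos w
  positivity

/-- … and sum to one over the sixteen answer pairs, for EVERY ordered pair of vertices (Parseval
in the two orthonormal bases; decided in exact arithmetic). [cite: CameronEtAl2007, §2 (ordered bases)] -/
theorem sum_bornQ : ∀ v w : Fin 14, ∑ α : Fin 4, ∑ β : Fin 4, bornQ v w α β = 1 := by
  decide +kernel

/-- Consistency: asked the same vertex, the players never answer different colours
(`⟨e_{vα}, e_{vβ}⟩ = 0` for `α ≠ β`). [cite: CameronEtAl2007, §2 Observation 1 (“⟨e_{vα}|⟨f_{vα}| Φ_c⟩ = 1/c”)] -/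
theorem bornQ_same_vertex : ∀ v : Fin 14, ∀ α β : Fin 4, α ≠ β → bornQ v v α β = 0 := by
  decide +kernel

/-- Colouring condition: asked adjacent vertices, the players never answer the same colour
(“∀ vw ∈ E and ∀ α ⟨e_{vα}|e_{wα}⟩ = 0”). [cite: CameronEtAl2007, §2 Observation 2, eq. (2)] -/
theorem bornQ_adj : ∀ v w : Fin 14, G14.Adj v w → ∀ α : Fin 4, bornQ v w α α = 0 := by
  decide +kernel

/-- The probability that the rank-1 strategy passes the referee's test on question `q = (v, w)`:
the total weight of the answer pairs satisfying `coloringRule`. [cite: CameronEtAl2007, §1–§2 (the test: same vertex ⇒ same colour, adjacent ⇒ different colours)] -/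
def passProb (q : Fin 14 × Fin 14) : ℚ :=
  ∑ α : Fin 4, ∑ β : Fin 4, if coloringRule G14 4 q α β then bornQ q.1 q.2 α β else 0

/-- **The quantum strategy wins EVERY question of the `G₁₄` game with probability one** — all 14
vertex questions and all 74 directed edge questions (“For this graph there exists a perfect
quantum strategy with 4 colors”), decided in exact rational arithmetic; against the classical
`86/88` of `classicalValue_ratio_G14`. [cite: ThanEtAl2026, p. 6; CameronEtAl2007, §2 (“win the graph colouring game with probability 1”); MancinskaRoberson2016, §4.3] -/
theorem passProb_eq_one : ∀ q ∈ coloringQuestions G14, passProb q = 1 := by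
  decide +kernel

/-- Hence the quantum value of the `G₁₄` four-colouring game under the uniform question weights
is `88/88 = 1`: the weighted pass probability over the 88 questions equals their number.
[cite: ThanEtAl2026, §1.2 (p. 6: “a perfect quantum strategy with 4 colors”) and §2.1 eq. (4) (p. 7)] -/
theorem sum_passProb : ∑ q ∈ coloringQuestions G14, passProb q = 88 := by
  rw [Finset.sum_congr rfl passProb_eq_one, Finset.sum_const, card_coloringQuestions_G14]
  norm_num

end PerfectStrategy


/-! ## From any quantum colouring to a perfect strategy (v4): the general statement

Sections `Quantum` and `PerfectStrategy` treated `G₁₄`.  Here the passage from Mančinska–Roberson's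
Definition 1 to winning the colouring game with probability one is made for EVERY quantum
`c`-colouring in dimension `d` (real form, over an ordered field such as `ℚ` or `ℝ`), in the model
of CMNSSW Proposition 1 (“w.l.o.g. the state is maximally entangled, and the POVM elements are all
projectors”; with `|Φ_d⟩` shared and Bob measuring the conjugate projectors, the Born rule gives
`P(α, β | v, w) = ⟨Φ_d| P_{vα} ⊗ conj P_{wβ} |Φ_d⟩ = Tr(P_{vα} P_{wβ})/d` — this trace form is TAKEN
AS THE DEFINITION, `traceProb`).  Two facts are proved: (i) completeness + idempotency force the
projectors of ONE vertex to be mutually orthogonal (`proj_mul_proj_of_ne` — the consistency half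
of CMNSSW eq. (1), obtained in their proof of Proposition 1 as “E_{vα} ρ E_{vβ} = 0 for all v
and α ≠ β”), via the trace argument `Σ_{k≠j} Tr((P_k P_j)ᴴ(P_k P_j)) = 0`; (ii) hence the trace
statistics sum to one on every question pair and pass every vertex question and every edge
question with probability one (`tracePass_eq_one`).  For `G₁₄` the rank-1 statistics `bornQ` of
the previous section ARE these trace statistics (`bornQ_eq_traceProb`, decided). -/

section General

open scoped Matrix

namespace QuantumColouring

variable {W : Type*} {H : SimpleGraph W} {c d : ℕ} {K : Type*}

/-- Real form: the projectors are self-adjoint (plumbing). [folklore] -/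
private theorem conjTranspose_proj [Field K] [StarRing K] [TrivialStar K]
    (Q : QuantumColouring H c d K) (v : W) (i : Fin c) :
    (Q.proj v i)ᴴ = Q.proj v i := by
  rw [Matrix.conjTranspose_eq_transpose_of_trivial, Q.symm]

/-- **The projectors of one vertex are mutually orthogonal**: `P_{v,i} P_{v,j} = 0` for `i ≠ j` —
forced by completeness `Σ_i P_{v,i} = I` and idempotency (the consistency condition “∀ v ∀ α ≠ β
⟨ψ|E_{vα} ⊗ F_{vβ}|ψ⟩ = 0” of CMNSSW eq. (1); in their proof of Proposition 1:
“E_{vα} ρ E_{vβ} = 0 for all v ∈ V and α ≠ β”).  Proof: `P_j (Σ_k P_k) P_j = P_j` leaves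
`Σ_{k ≠ j} P_j P_k P_j = 0`, each term is `(P_k P_j)ᴴ (P_k P_j)` with nonnegative trace, so each
`P_k P_j = 0`. [cite: CameronEtAl2007, §2 eq. (1) and the proof of Proposition 1 (“E_{vα} ρ E_{vβ} = 0”); MancinskaRoberson2016, §2 Definition 1 (“Note that v_i w_i = 0 is equivalent to tr(v_i w_i) = 0 since these are positive semidefinite operators”)] -/
theorem proj_mul_proj_of_ne [Field K] [PartialOrder K] [StarRing K] [StarOrderedRing K]
    [TrivialStar K] (Q : QuantumColouring H c d K) (v : W) {i j : Fin c} (hij : i ≠ j) :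
    Q.proj v i * Q.proj v j = 0 := by
  classical
  set f : Fin c → Matrix (Fin d) (Fin d) K := fun k => Q.proj v j * Q.proj v k * Q.proj v j
    with hf
  have hsum : ∑ k, f k = Q.proj v j := by
    simp only [hf]
    rw [← Finset.sum_mul, ← Finset.mul_sum, Q.complete, Matrix.mul_one, Q.idem]
  have hjj : f j = Q.proj v j := by simp only [hf]; rw [Q.idem, Q.idem]
  have hrest : ∑ k ∈ Finset.univ.erase j, f k = 0 := by
    have h := Finset.add_sum_erase Finset.univ f (Finset.mem_univ j)
    rw [hsum, hjj] at h
    -- h : P_j + rest = P_j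
    have h' : Q.proj v j + ∑ k ∈ Finset.univ.erase j, f k = Q.proj v j + 0 := by rw [h, add_zero]
    exact add_left_cancel h'
  have hterm : ∀ k, f k = (Q.proj v k * Q.proj v j)ᴴ * (Q.proj v k * Q.proj v j) := by
    intro k
    simp only [hf, Matrix.conjTranspose_mul, conjTranspose_proj, Matrix.mul_assoc]
    rw [← Matrix.mul_assoc (Q.proj v k) (Q.proj v k) (Q.proj v j), Q.idem]
  have htr : ∑ k ∈ Finset.univ.erase j,
      Matrix.trace ((Q.proj v k * Q.proj v j)ᴴ * (Q.proj v k * Q.proj v j)) = 0 := by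
    rw [← Matrix.trace_sum]
    have : ∑ k ∈ Finset.univ.erase j, (Q.proj v k * Q.proj v j)ᴴ * (Q.proj v k * Q.proj v j) =
        ∑ k ∈ Finset.univ.erase j, f k := Finset.sum_congr rfl fun k _ => (hterm k).symm
    rw [this, hrest, Matrix.trace_zero]
  have hnonneg : ∀ k ∈ Finset.univ.erase j,
      0 ≤ Matrix.trace ((Q.proj v k * Q.proj v j)ᴴ * (Q.proj v k * Q.proj v j)) :=
    fun k _ => (Matrix.posSemidef_conjTranspose_mul_self _).trace_nonneg
  have hi := (Finset.sum_eq_zero_iff_of_nonneg hnonneg).1 htr i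
    (Finset.mem_erase.2 ⟨hij, Finset.mem_univ i⟩)
  exact Matrix.trace_conjTranspose_mul_self_eq_zero_iff.1 hi

/-- **Outcome statistics of the projector strategy** in the maximally-entangled model of CMNSSW
Proposition 1: `P(α, β | v, w) = Tr(P_{vα} P_{wβ})/d` (Alice measures `{P_{vα}}`, Bob the
conjugate projectors, on `|Φ_d⟩`) — taken as the definition. [cite: CameronEtAl2007, §2 Proposition 1 (“w.l.o.g. the state is maximally entangled, and the POVM elements are all projectors”) and its proof (“F_{vα} = conj E_{vα}”)] -/
def traceProb [Field K] (Q : QuantumColouring H c d K) (v w : W) (α β : Fin c) : K :=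
  Matrix.trace (Q.proj v α * Q.proj w β) / d

/-- The statistics sum to one on every question pair (`Tr((Σ_α P_{vα})(Σ_β P_{wβ})) = Tr I = d`).
[cite: CameronEtAl2007, §2 (POVMs: “two families of POVMs (E_{vα}) and (F_{vβ})”)] -/
theorem sum_traceProb [Field K] (Q : QuantumColouring H c d K) (hd : (d : K) ≠ 0) (v w : W) :
    ∑ α, ∑ β, Q.traceProb v w α β = 1 := by
  unfold traceProb
  simp_rw [← Finset.sum_div, ← Matrix.trace_sum, ← Finset.mul_sum, ← Finset.sum_mul]
  rw [Q.complete, Q.complete, Matrix.mul_one, Matrix.trace_one, Fintype.card_fin]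
  exact div_self hd

/-- Same vertex, different colours: probability zero (consistency).
[cite: CameronEtAl2007, §2 eq. (1), first line (“∀ v ∈ V ∀ α ≠ β ⟨ψ|E_{vα} ⊗ F_{vβ}|ψ⟩ = 0”)] -/
theorem traceProb_same_vertex [Field K] [PartialOrder K] [StarRing K] [StarOrderedRing K]
    [TrivialStar K] (Q : QuantumColouring H c d K) (v : W) {α β : Fin c} (h : α ≠ β) :
    Q.traceProb v v α β = 0 := by
  unfold traceProb
  rw [Q.proj_mul_proj_of_ne v h, Matrix.trace_zero, zero_div]

/-- Adjacent vertices, equal colours: probability zero (the colouring condition).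
[cite: CameronEtAl2007, §2 eq. (1), second line (“∀ vw ∈ E ∀ α ⟨ψ|E_{vα} ⊗ F_{wα}|ψ⟩ = 0”) and eq. (3) (“E_{vα}E_{wα} = 0”)] -/
theorem traceProb_adj [Field K] (Q : QuantumColouring H c d K) {v w : W} (h : H.Adj v w)
    (α : Fin c) : Q.traceProb v w α α = 0 := by
  unfold traceProb
  rw [Q.orth v w h α, Matrix.trace_zero, zero_div]

/-- **Every quantum `c`-colouring wins the colouring game with probability one**: on every asked
question `(v, w)` (a vertex question `v = w` or an edge question `v ∼ w`) the total probability
of the answer pairs allowed by the rule is `1`. [cite: CameronEtAl2007, §2 (“The fact that they win with probability 1 is expressed by the consistency condition (1)”); MancinskaRoberson2016, §2 (“quantum colorings were introduced as quantum strategies for a certain nonlocal game”)] -/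
theorem tracePass_eq_one [Field K] [PartialOrder K] [StarRing K] [StarOrderedRing K]
    [TrivialStar K] [DecidableEq W] [DecidableRel H.Adj] (Q : QuantumColouring H c d K)
    (hd : (d : K) ≠ 0) (q : W × W) :
    (∑ α, ∑ β, if coloringRule H c q α β then Q.traceProb q.1 q.2 α β else 0) = 1 := by
  rw [← Q.sum_traceProb hd q.1 q.2]
  refine Finset.sum_congr rfl fun α _ => Finset.sum_congr rfl fun β _ => ?_
  split_ifs with hr
  · rfl
  · -- the rule fails: either a vertex question answered with α ≠ β, or an edge with α = β
    unfold coloringRule at hr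
    rw [not_and_or] at hr
    rcases hr with h1 | h2
    · obtain ⟨he, hne⟩ := Classical.not_imp.1 h1
      rw [← he]
      exact (Q.traceProb_same_vertex q.1 hne).symm
    · obtain ⟨ha, hnn⟩ := Classical.not_imp.1 h2
      have heq : α = β := of_not_not hnn
      subst heq
      exact (Q.traceProb_adj ha α).symm

end QuantumColouring

/-- For `G₁₄` the rank-1 statistics `bornQ` of section `PerfectStrategy` ARE the trace statistics of
the quantum 4-colouring `quantumFourColouring_G14` (`Tr(uuᵀ vvᵀ)/‖u‖²‖v‖² = ⟨u,v⟩²/…`), decided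
entrywise. [cite: CameronEtAl2007, §2 (rank-1 model = Proposition 1's model with rank-1 projectors)] -/
theorem bornQ_eq_traceProb :
    ∀ v w : Fin 14, ∀ α β : Fin 4,
      bornQ v w α β = quantumFourColouring_G14.traceProb v w α β := by
  decide +kernel

end General

end G14Game

end Literature.Computability.QuantumComplexity
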